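import Summits.ResolutionOfSingularities.ResolutionOfSingularities.Theorems.EquisingularLiftEquisingularLiftNatCentreCodimTwo
import Literature.AlgebraicGeometry.Resolution.RegularSequenceSpread
import Mathlib.AlgebraicGeometry.Noetherian
import HarnessLib

/-!
# [OURS · L1 W4.5(b) · EL♮(3)] (T-k) brick P2, ring core — a part of a regular system of parameters at `p` is a weakly regular
# sequence on some `A[1/g]`, `g ∉ p`

Crux chain w45b (cell `res-hironaka`, slot W4.5(b)), child crux **EL♮(3)** = stmt-ResolutionOfSingularities-20148, route EquisingularLift;
hypothesis-residue (T-k) `EmbeddedCurveLiftFact`, res-type-027 g16's census (`L/res-type-027/EMBEDDED-CURVE-LIFT-CENSUS.md` 23253b6cd880a2d6),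
brick **P2** `locallyRegularSequence_of_isRegular` (sig `L/res-type-027/EmbeddedCurveLift-Tk.sig.lean` b8b6b462233a4b0c l.86–92): «a closed
immersion of a regular scheme into a scheme regular along it is cut out, near every point, by a weakly regular sequence». This file is the
commutative-algebra heart of its step (4) (res-D-pv-035 census line, `res-hironaka/STATUS.md` 2026-08-28T02:00:15Z): the `IsWeaklyRegular`
twin of the tree's `exists_isQuasiRegular_away_of_isRsopPart`. Written by res-D-pv-035 g9. HONEST FRAMING: OURS; NOT a statement of any
manuscript; AI-written, weaker than expert review. No `sorry`; standard axioms; DEF-FREE. `--supports stmt-ResolutionOfSingularities-20148 --as helper`.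

* (bridge colon form ⇒ `RingTheory.Sequence.IsWeaklyRegular`: the tree's `isWeaklyRegular_ofFn_of_regularSeq`, …NatCentreCodimTwo.)
* `exists_away_isWeaklyRegular_of_isRsopPart` — **local-to-neighbourhood for regular sequences**: `A` Noetherian, `p` prime, `u₁, …, u_c ∈ A`
  whose images in (any localisation `Ap` of `A` at `p`, e.g. a stalk) are part of a regular system of parameters ⊢ for some `g ∉ p`, in EVERY
  localisation `A[1/g]` the images of the `u_i` form a weakly regular sequence (uniform multiplier `exists_uniform_multiplier_of_regular_at_prime`
  + `regularSeq_map_of_uniform_multiplier`, tree `RegularCentreLocal`).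
* `exists_basicOpen_isWeaklyRegular_of_isRsopPart_germ` — the SCHEME form: `U` an affine open of a locally Noetherian scheme, sections whose
  germs at `x` are part of a regular system of parameters of `𝒪_{X,x}` ⊢ they restrict to a weakly regular sequence on `Γ(X, D(g))` for a
  basic open `D(g) ∋ x` of `U` (`IsAffineOpen.isLocalization_stalk` / `isLocalization_basicOpen`).

References (method): H. Matsumura, *Commutative Ring Theory* (1986), Thms. 14.3, 16.1; Stacks Project Tag 061L (regular sequences and
localisation); index only.
-/

set_option linter.dupNamespace false -- mandated namespace `Summit.<Summit>.<Problem>` of this single-conjunct summit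

noncomputable section

open IsLocalRing Literature.AlgebraicGeometry.Resolution

namespace Summit.ResolutionOfSingularities.ResolutionOfSingularities.Cruxes.EquisingularLiftNat.Sections

universe u v

/-- **Local-to-neighbourhood for regular sequences.** Let `A` be Noetherian, `p` a prime and `u₁, …, u_c ∈ A` whose images in `A_p` are part
of a regular system of parameters (`A_p` = ANY localisation `Ap` of `A` at `p`, e.g. the stalk of an affine scheme). Then for some `g ∉ p` the
images of the `u_i` in every localisation `A[1/g]` form a weakly regular sequence. (The `IsWeaklyRegular` twin of the tree's
`exists_isQuasiRegular_away_of_isRsopPart`.) [folklore; Stacks Project Tag 061L, index only] -/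
theorem exists_away_isWeaklyRegular_of_isRsopPart {A : Type u} [CommRing A] [IsNoetherianRing A]
    (p : Ideal A) [p.IsPrime] (Ap : Type v) [CommRing Ap] [Algebra A Ap] [IsLocalization.AtPrime Ap p] [IsLocalRing Ap]
    {c : ℕ} (u : Fin c → A) (h : IsRsopPart (fun i => algebraMap A Ap (u i))) :
    ∃ g : A, g ∉ p ∧ ∀ (L : Type u) [CommRing L] [Algebra A L] [IsLocalization.Away g L],
      RingTheory.Sequence.IsWeaklyRegular L (List.ofFn fun i => algebraMap A L (u i)) := by
  -- colon form of the `A_p`-sequence, over `A`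
  have hreg : ∀ (i : Fin c) (y : A), u i * y ∈ Ideal.span (u '' Set.Iio i) →
      ∃ s : A, s ∉ p ∧ s * y ∈ Ideal.span (u '' Set.Iio i) := by
    intro i y hy
    have himg : (fun i => algebraMap A Ap (u i)) '' Set.Iio i = algebraMap A Ap '' (u '' Set.Iio i) := by
      rw [Set.image_image]
    have h1 : algebraMap A Ap (u i) * algebraMap A Ap y ∈ Ideal.span ((fun i => algebraMap A Ap (u i)) '' Set.Iio i) := by
      rw [himg, ← Ideal.map_span, ← map_mul]
      exact Ideal.mem_map_of_mem _ hy
    have h2 := h.mem_of_mul_mem i _ h1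
    rw [himg, ← Ideal.map_span, IsLocalization.algebraMap_mem_map_algebraMap_iff p.primeCompl] at h2
    obtain ⟨s, hs, hsy⟩ := h2
    exact ⟨s, hs, hsy⟩
  -- a uniform multiplier `g ∉ p`, and the colon form in every `A[1/g]`
  obtain ⟨g, hgp, hg⟩ := exists_uniform_multiplier_of_regular_at_prime u p hreg
  refine ⟨g, hgp, fun L _ _ _ => isWeaklyRegular_ofFn_of_regularSeq _ fun i z hz => ?_⟩
  have key := regularSeq_map_of_uniform_multiplier u hg L i z
  exact key hz

open AlgebraicGeometry CategoryTheory in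
/-- **Scheme form (the step (4) of P2)**: on an affine open `U` of a locally Noetherian scheme, sections `u₁, …, u_c ∈ Γ(X, U)` whose GERMS
at `x ∈ U` are part of a regular system of parameters of `𝒪_{X,x}` restrict to a weakly regular sequence on `Γ(X, D(g))` for some basic open
`D(g) ∋ x` of `U`. [folklore; OURS · L1 W4.5b · (T-k) P2 step (4)] -/
theorem exists_basicOpen_isWeaklyRegular_of_isRsopPart_germ {X : Scheme.{u}} [IsLocallyNoetherian X] (U : X.affineOpens) {x : X}
    (hx : x ∈ (U : X.Opens)) {c : ℕ} (u : Fin c → Γ(X, U))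
    (h : IsRsopPart (fun i => (X.presheaf.germ U x hx).hom (u i))) :
    ∃ g : Γ(X, U), x ∈ X.basicOpen g ∧
      RingTheory.Sequence.IsWeaklyRegular Γ(X, X.basicOpen g)
        (List.ofFn fun i => (X.presheaf.map (homOfLE (X.basicOpen_le g)).op).hom (u i)) := by
  haveI : IsNoetherianRing Γ(X, U) := IsLocallyNoetherian.component_noetherian U
  letI : Algebra Γ(X, U) (X.presheaf.stalk x) := X.presheaf.algebra_section_stalk (⟨x, hx⟩ : (U : X.Opens))
  haveI : IsLocalization.AtPrime (X.presheaf.stalk x) (U.2.primeIdealOf ⟨x, hx⟩).asIdeal := U.2.isLocalization_stalk ⟨x, hx⟩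
  obtain ⟨g, hgp, hg⟩ := exists_away_isWeaklyRegular_of_isRsopPart (U.2.primeIdealOf ⟨x, hx⟩).asIdeal (X.presheaf.stalk x) u h
  refine ⟨g, ?_, ?_⟩
  · rw [X.mem_basicOpen g x hx]
    exact (IsLocalization.AtPrime.isUnit_to_map_iff (X.presheaf.stalk x) (U.2.primeIdealOf ⟨x, hx⟩).asIdeal g).mpr hgp
  · haveI : IsLocalization.Away g Γ(X, X.basicOpen g) := U.2.isLocalization_basicOpen g
    exact hg Γ(X, X.basicOpen g)

end Summit.ResolutionOfSingularities.ResolutionOfSingularities.Cruxes.EquisingularLiftNat.Sections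

end
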